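import Literature.Analysis.Hypoelliptic.KernelOperators
import HarnessLib

/-!
# Composition of kernel operators and the second commutator gain

Analysis/Hypoelliptic support file, third piece of the Fourier-side toolkit serving the
discharge of `Literature.Analysis.Distribution.Hormander1967_thm11` by Kohn's method
(M. Taylor, *Pseudodifferential Operators* (1981), Ch. XV §1). Continues
`KernelOperators.lean`.

* `kerComp K₁ K₂ ξ η = ∫ K₁ ξ ζ K₂ ζ η dζ`, the certificate `KerDecay.comp` (orders add,
  constants explicit) and the Fubini identity `kerOp (kerComp K₁ K₂) F = kerOp K₁ (kerOp K₂ F)`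
  on functions of finite weighted norm ("composition of operators of orders `m₁`, `m₂` is of
  order `m₁ + m₂`", Taylor 1981, Ch. II, Thm 4.4, pseudo-differential version).
* **The second commutator gain.** For a multiplier `φ` whose second differences are of
  order `m₂` (`MulDiff2`: `‖φ(η+u+v) - φ(η+u) - φ(η+v) + φ η‖ ≤ d ⟨u⟩^M ⟨v⟩^M ⟨η⟩^{m₂}`;
  `m₂ = a - 2` for the symbol `⟨ξ⟩^a`) and rapidly decreasing `θ, θ'`, the double commutator
  `[conv θ, [φ, conv θ']]` is the kernel operator of
  `dcommKer θ θ' φ ξ η = ∫ θ(ξ-ζ) θ'(ζ-η) (φ ζ - φ η - φ ξ + φ (ξ+η-ζ)) dζ`, which is of order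
  `m₂`: the kernel identity `kerComp (convKer θ) T - kerComp T (convKer θ) = dcommKer`
  (`T = (φ ζ - φ η) θ'(ζ - η)`, by the change of variables `ζ ↦ ξ + η - ζ`) and its
  certificate. This is the gain of two derivatives in `[b, [⟨D⟩^a, a]]` needed for the
  double commutators `[X, [X, ⟨D⟩^a]]` of Kohn's proof.

## References

* M. E. Taylor, *Pseudodifferential Operators* (1981), Ch. II §4; Ch. XV §1.
-/

noncomputable section

open MeasureTheory Set Filter Function
open scoped ENNReal NNReal Topology ComplexConjugate

namespace Literature.Analysis.Hypoelliptic

section Defs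

variable {V : Type*} [NormedAddCommGroup V] [MeasurableSpace V]

/-- **Second differences of order `m₂`** for a multiplier `φ`, with constants `d, M`:
`‖φ (η + u + v) - φ (η + u) - φ (η + v) + φ η‖ ≤ d ⟨u⟩^M ⟨v⟩^M ⟨η⟩^{m₂}`. [folklore] -/
structure MulDiff2 (φ : V → ℂ) (m₂ : ℝ) (d M : ℝ) : Prop where
  measurable : Measurable φ
  nonneg : 0 ≤ d
  bound : ∀ η u v, ‖φ (η + u + v) - φ (η + u) - φ (η + v) + φ η‖ ≤
    d * bw M u * bw M v * bw m₂ η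

/-- The commutator kernel of `[φ, conv θ']`: `(φ ζ - φ η) θ'(ζ - η)`. [folklore] -/
def commConvKer (φ : V → ℂ) (θ' : V → ℂ) (ζ η : V) : ℂ :=
  (φ ζ - φ η) * θ' (ζ - η)

omit [MeasurableSpace V] in
/-- `commConvKer` is the commutator kernel of `KerDecay.comm_mul` for the convolution kernel.
[folklore] -/
theorem commConvKer_eq (φ θ' : V → ℂ) :
    commConvKer φ θ' = fun ζ η => (φ ζ - φ η) * convKer θ' ζ η := rfl

end Defs

variable {V : Type*} [NormedAddCommGroup V] [InnerProductSpace ℝ V] [FiniteDimensional ℝ V]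
  [MeasurableSpace V] [BorelSpace V]

/-! ### Integrable majorants -/

/-- `⟨ζ⟩^{-r}` is integrable for `r > n`. [folklore] -/
theorem integrable_bw_neg {r : ℝ} (hr : (Module.finrank ℝ V : ℝ) < r) :
    Integrable (bw (V := V) (-r)) volume :=
  integrable_rpow_neg_one_add_norm_sq hr

/-- The standard integrable decay weight `⟨ζ⟩^{-(n+1)}`. [folklore] -/
theorem integrable_bw_neg_finrank_add_one :
    Integrable (bw (V := V) (-(Module.finrank ℝ V + 1 : ℝ))) volume :=
  integrable_bw_neg (by linarith)

variable (V) in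
/-- `I₁ = ∫ ⟨ζ⟩^{-(n+1)} dζ`, the integral of the standard decay weight. [folklore] -/
def I₁ : ℝ :=
  ∫ ζ : V, bw (-(Module.finrank ℝ V + 1 : ℝ)) ζ

/-- `I₁ ≥ 0`. [folklore] -/
theorem I₁_nonneg : 0 ≤ I₁ V := integral_nonneg fun ζ => bw_nonneg _ ζ

/-- A function dominated by `c ⟨ξ - ζ⟩^{-(n+1)}` is integrable. [folklore] -/
theorem integrable_of_norm_le_bw {E' : Type*} [NormedAddCommGroup E'] {g : V → E'}
    (hg : AEStronglyMeasurable g volume) {c : ℝ} (ξ : V)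
    (h : ∀ ζ, ‖g ζ‖ ≤ c * bw (-(Module.finrank ℝ V + 1 : ℝ)) (ξ - ζ)) : Integrable g volume :=
  Integrable.mono' ((integrable_bw_neg_finrank_add_one.comp_sub_left ξ).const_mul c) hg
    (Eventually.of_forall h)

/-- The decay index absorbing a weight of order `r` into the standard decay weight:
`⌈|r|⌉ + n + 1`. [folklore] -/
def absorbIndex (V : Type*) [NormedAddCommGroup V] [InnerProductSpace ℝ V] (r : ℝ) : ℕ :=
  Module.finrank ℝ V + 1 + ⌈|r|⌉₊

omit [FiniteDimensional ℝ V] [MeasurableSpace V] [BorelSpace V] in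
/-- `⟨x⟩^{|r|} ⟨x⟩^{-absorbIndex r} ≤ ⟨x⟩^{-(n+1)}`. [folklore] -/
theorem bw_abs_mul_bw_neg_absorbIndex_le (r : ℝ) (x : V) :
    bw |r| x * bw (-(absorbIndex V r : ℕ)) x ≤ bw (-(Module.finrank ℝ V + 1 : ℝ)) x := by
  have h := bw_mul_bw_neg_add_ceil_le |r| (Module.finrank ℝ V + 1) x
  unfold absorbIndex
  push_cast at h ⊢
  exact h

/-- **A kernel row times a polynomially bounded function is integrable**:
`ζ ↦ K ξ ζ * G ζ` for `‖G ζ‖ ≤ c ⟨ζ⟩^r`. [folklore] -/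
theorem KerDecay.integrable_mul_of_norm_le {K : V → V → ℂ} {m : ℝ} {C : ℕ → ℝ}
    (h : KerDecay K m C) {G : V → ℂ} (hG : AEStronglyMeasurable G volume) {c r : ℝ}
    (hc : 0 ≤ c) (hGb : ∀ ζ, ‖G ζ‖ ≤ c * bw r ζ) (ξ : V) :
    Integrable (fun ζ => K ξ ζ * G ζ) volume := by
  set N : ℕ := absorbIndex V (m + r) with hN
  refine integrable_of_norm_le_bw ((h.measurable_right ξ).aestronglyMeasurable.mul hG)
    (c := C N * c * 2 ^ (|m + r| / 2) * bw (m + r) ξ) ξ fun ζ => ?_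
  rw [norm_mul]
  have hP := bw_le_bw_mul_bw_sub' (m + r) ξ ζ
  have hA := bw_abs_mul_bw_neg_absorbIndex_le (m + r) (ξ - ζ)
  rw [← hN] at hA
  calc ‖K ξ ζ‖ * ‖G ζ‖ ≤ (C N * bw (-N) (ξ - ζ) * bw m ζ) * (c * bw r ζ) :=
        mul_le_mul (h.bound N ξ ζ) (hGb ζ) (norm_nonneg _)
          (mul_nonneg (mul_nonneg (h.nonneg N) (bw_nonneg _ _)) (bw_nonneg _ _))
    _ = C N * c * bw (-N) (ξ - ζ) * (bw m ζ * bw r ζ) := by ring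
    _ = C N * c * bw (-N) (ξ - ζ) * bw (m + r) ζ := by rw [bw_add]
    _ ≤ C N * c * bw (-N) (ξ - ζ) * (2 ^ (|m + r| / 2) * bw (m + r) ξ * bw |m + r| (ξ - ζ)) :=
        mul_le_mul_of_nonneg_left hP
          (mul_nonneg (mul_nonneg (h.nonneg N) hc) (bw_nonneg _ _))
    _ = C N * c * 2 ^ (|m + r| / 2) * bw (m + r) ξ * (bw |m + r| (ξ - ζ) * bw (-N) (ξ - ζ)) := by
        ring
    _ ≤ C N * c * 2 ^ (|m + r| / 2) * bw (m + r) ξ *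
          bw (-(Module.finrank ℝ V + 1 : ℝ)) (ξ - ζ) :=
        mul_le_mul_of_nonneg_left hA (mul_nonneg (mul_nonneg (mul_nonneg (h.nonneg N) hc)
          (by positivity)) (bw_nonneg _ _))

/-- A kernel row times a polynomially bounded real function is integrable (real version, for
norms). [folklore] -/
theorem KerDecay.integrable_norm_mul_of_norm_le {K : V → V → ℂ} {m : ℝ} {C : ℕ → ℝ}
    (h : KerDecay K m C) {g : V → ℝ} (hg : AEStronglyMeasurable g volume) {c r : ℝ}
    (hc : 0 ≤ c) (hgb : ∀ ζ, ‖g ζ‖ ≤ c * bw r ζ) (ξ : V) :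
    Integrable (fun ζ => ‖K ξ ζ‖ * g ζ) volume := by
  have h1 := h.integrable_mul_of_norm_le (G := fun ζ => (g ζ : ℂ))
    (Complex.continuous_ofReal.comp_aestronglyMeasurable hg) hc
    (fun ζ => by rw [Complex.norm_real]; exact hgb ζ) ξ
  refine Integrable.mono' h1.norm ((h.measurable_right ξ).norm.aestronglyMeasurable.mul hg)
    (Eventually.of_forall fun ζ => ?_)
  rw [norm_mul, norm_mul, norm_norm, Complex.norm_real]

/-! ### Composition -/

/-- The composition kernel `(K₁ ∘ K₂)(ξ, η) = ∫ K₁ ξ ζ K₂ ζ η dζ`. [folklore] -/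
def kerComp (K₁ K₂ : V → V → ℂ) (ξ η : V) : ℂ :=
  ∫ ζ, K₁ ξ ζ * K₂ ζ η

/-- The constants of the composition of kernels of orders `m₁` (constants `C₁`) and `m₂`
(constants `C₂`). [folklore] -/
def compConst (V : Type*) [NormedAddCommGroup V] [InnerProductSpace ℝ V]
    [FiniteDimensional ℝ V] [MeasurableSpace V] [BorelSpace V]
    (m₁ : ℝ) (C₁ C₂ : ℕ → ℝ) (N : ℕ) : ℝ :=
  C₁ N * C₂ (N + absorbIndex V m₁) * 2 ^ (|m₁| / 2) * 2 ^ ((N : ℝ) / 2) * I₁ V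

omit [FiniteDimensional ℝ V] [BorelSpace V] in
/-- The pointwise majorant of the composition integrand:
`‖K₁ ξ ζ K₂ ζ η‖ ≤ c · ⟨ξ-η⟩^{-N} ⟨η⟩^{m₁+m₂} · ⟨ζ-η⟩^{-(n+1)}` with
`c = C₁ N · C₂ (N + absorbIndex m₁) · 2^{|m₁|/2} · 2^{N/2}`. [folklore] -/
theorem KerDecay.norm_mul_le_comp {K₁ K₂ : V → V → ℂ} {m₁ m₂ : ℝ} {C₁ C₂ : ℕ → ℝ}
    (h₁ : KerDecay K₁ m₁ C₁) (h₂ : KerDecay K₂ m₂ C₂) (N : ℕ) (ξ ζ η : V) :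
    ‖K₁ ξ ζ * K₂ ζ η‖ ≤
      C₁ N * C₂ (N + absorbIndex V m₁) * 2 ^ (|m₁| / 2) * 2 ^ ((N : ℝ) / 2) *
        bw (-N) (ξ - η) * bw (m₁ + m₂) η * bw (-(Module.finrank ℝ V + 1 : ℝ)) (ζ - η) := by
  set N₂ : ℕ := N + absorbIndex V m₁ with hN₂
  rw [norm_mul]
  have hb₁ := h₁.bound N ξ ζ
  have hb₂ := h₂.bound N₂ ζ η
  have hP := bw_le_bw_mul_bw_sub m₁ ζ η
  have hA := bw_abs_mul_bw_neg_absorbIndex_le m₁ (ζ - η)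
  have hQ := bw_neg_mul_bw_neg_le (Nat.cast_nonneg N) ξ ζ η
  have hsplit : bw (-(N₂ : ℕ)) (ζ - η) = bw (-N) (ζ - η) * bw (-(absorbIndex V m₁ : ℕ)) (ζ - η) := by
    rw [← bw_add, hN₂]; push_cast; ring_nf
  have c_nn : 0 ≤ C₁ N * C₂ N₂ * 2 ^ (|m₁| / 2) :=
    mul_nonneg (mul_nonneg (h₁.nonneg _) (h₂.nonneg _)) (by positivity)
  calc ‖K₁ ξ ζ‖ * ‖K₂ ζ η‖
      ≤ (C₁ N * bw (-N) (ξ - ζ) * bw m₁ ζ) * (C₂ N₂ * bw (-(N₂ : ℕ)) (ζ - η) * bw m₂ η) :=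
        mul_le_mul hb₁ hb₂ (norm_nonneg _)
          (mul_nonneg (mul_nonneg (h₁.nonneg _) (bw_nonneg _ _)) (bw_nonneg _ _))
    _ ≤ (C₁ N * bw (-N) (ξ - ζ) * (2 ^ (|m₁| / 2) * bw m₁ η * bw |m₁| (ζ - η))) *
          (C₂ N₂ * bw (-(N₂ : ℕ)) (ζ - η) * bw m₂ η) :=
        mul_le_mul_of_nonneg_right (mul_le_mul_of_nonneg_left hP
          (mul_nonneg (h₁.nonneg _) (bw_nonneg _ _)))
          (mul_nonneg (mul_nonneg (h₂.nonneg _) (bw_nonneg _ _)) (bw_nonneg _ _))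
    _ = C₁ N * C₂ N₂ * 2 ^ (|m₁| / 2) * (bw (-N) (ξ - ζ) * bw (-N) (ζ - η)) *
          (bw |m₁| (ζ - η) * bw (-(absorbIndex V m₁ : ℕ)) (ζ - η)) * (bw m₁ η * bw m₂ η) := by
        rw [hsplit]; ring
    _ ≤ C₁ N * C₂ N₂ * 2 ^ (|m₁| / 2) * (2 ^ ((N : ℝ) / 2) * bw (-N) (ξ - η)) *
          bw (-(Module.finrank ℝ V + 1 : ℝ)) (ζ - η) * (bw m₁ η * bw m₂ η) := by
        refine mul_le_mul_of_nonneg_right ?_ (mul_nonneg (bw_nonneg _ _) (bw_nonneg _ _))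
        exact mul_le_mul (mul_le_mul_of_nonneg_left hQ c_nn) hA
          (mul_nonneg (bw_nonneg _ _) (bw_nonneg _ _))
          (mul_nonneg c_nn (mul_nonneg (by positivity) (bw_nonneg _ _)))
    _ = _ := by rw [bw_add]; ring

/-- The composition integrand is integrable in the middle variable. [folklore] -/
theorem KerDecay.integrable_comp {K₁ K₂ : V → V → ℂ} {m₁ m₂ : ℝ} {C₁ C₂ : ℕ → ℝ}
    (h₁ : KerDecay K₁ m₁ C₁) (h₂ : KerDecay K₂ m₂ C₂) (ξ η : V) :
    Integrable (fun ζ => K₁ ξ ζ * K₂ ζ η) volume := by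
  refine integrable_of_norm_le_bw
    ((h₁.measurable_right ξ).aestronglyMeasurable.mul (h₂.measurable_left η).aestronglyMeasurable)
    (c := C₁ 0 * C₂ (0 + absorbIndex V m₁) * 2 ^ (|m₁| / 2) * 2 ^ ((0 : ℕ) / 2 : ℝ) *
      bw (-(0 : ℕ)) (ξ - η) * bw (m₁ + m₂) η) η fun ζ => ?_
  rw [bw_sub_comm _ η ζ]
  exact h₁.norm_mul_le_comp h₂ 0 ξ ζ η

/-- The composition kernel is jointly measurable. [folklore] -/
theorem KerDecay.measurable_kerComp {K₁ K₂ : V → V → ℂ} {m₁ m₂ : ℝ} {C₁ C₂ : ℕ → ℝ}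
    (h₁ : KerDecay K₁ m₁ C₁) (h₂ : KerDecay K₂ m₂ C₂) :
    Measurable (uncurry (kerComp K₁ K₂)) := by
  -- `((ξ, η), ζ) ↦ K₁ ξ ζ * K₂ ζ η` is measurable on `(V × V) × V`
  have hm : Measurable fun p : (V × V) × V => K₁ p.1.1 p.2 * K₂ p.2 p.1.2 :=
    (h₁.measurable.comp (measurable_fst.fst.prodMk measurable_snd)).mul
      (h₂.measurable.comp (measurable_snd.prodMk measurable_fst.snd))
  have hsm : StronglyMeasurable fun p : (V × V) × V => K₁ p.1.1 p.2 * K₂ p.2 p.1.2 :=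
    hm.stronglyMeasurable
  have := hsm.integral_prod_right' (ν := volume)
  exact this.measurable

/-- **Composition of kernels of orders `m₁`, `m₂` is a kernel of order `m₁ + m₂`** (constants
`compConst m₁ C₁ C₂`). [folklore] -/
theorem KerDecay.comp {K₁ K₂ : V → V → ℂ} {m₁ m₂ : ℝ} {C₁ C₂ : ℕ → ℝ}
    (h₁ : KerDecay K₁ m₁ C₁) (h₂ : KerDecay K₂ m₂ C₂) :
    KerDecay (kerComp K₁ K₂) (m₁ + m₂) (compConst V m₁ C₁ C₂) where
  measurable := h₁.measurable_kerComp h₂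
  nonneg N := mul_nonneg (mul_nonneg (mul_nonneg (mul_nonneg (h₁.nonneg _) (h₂.nonneg _))
    (by positivity)) (by positivity)) I₁_nonneg
  bound N ξ η := by
    set c : ℝ := C₁ N * C₂ (N + absorbIndex V m₁) * 2 ^ (|m₁| / 2) * 2 ^ ((N : ℝ) / 2) *
      bw (-N) (ξ - η) * bw (m₁ + m₂) η with hc
    have hg : Integrable (fun ζ => c * bw (-(Module.finrank ℝ V + 1 : ℝ)) (ζ - η)) volume :=
      (integrable_bw_neg_finrank_add_one.comp_sub_right η).const_mul c
    calc ‖kerComp K₁ K₂ ξ η‖ ≤ ∫ ζ, c * bw (-(Module.finrank ℝ V + 1 : ℝ)) (ζ - η) :=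
          norm_integral_le_of_norm_le hg (Eventually.of_forall fun ζ => by
            rw [hc]; exact h₁.norm_mul_le_comp h₂ N ξ ζ η)
      _ = c * I₁ V := by
          rw [integral_const_mul, I₁]
          congr 1
          exact integral_sub_right_eq_self (fun ζ => bw (-(Module.finrank ℝ V + 1 : ℝ)) ζ) η
      _ = compConst V m₁ C₁ C₂ N * bw (-N) (ξ - η) * bw (m₁ + m₂) η := by
          rw [hc, compConst]; ring

/-- **The Fubini identity for composition**: `kerOp (K₁ ∘ K₂) F = kerOp K₁ (kerOp K₂ F)` for
`F` of finite weighted norm. [folklore] -/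
theorem KerDecay.kerOp_kerComp {K₁ K₂ : V → V → ℂ} {m₁ m₂ : ℝ} {C₁ C₂ : ℕ → ℝ}
    (h₁ : KerDecay K₁ m₁ C₁) (h₂ : KerDecay K₂ m₂ C₂) {t : ℝ} {F : V → ℂ} (hF : InH t F) :
    kerOp (kerComp K₁ K₂) F = kerOp K₁ (kerOp K₂ F) := by
  -- reduce to a measurable `F`
  obtain ⟨F', hF'm, hFF'⟩ := hF.1
  have hF't : wnorm t F' < ∞ := by rw [← wnorm_congr_ae hFF']; exact hF.2
  rw [kerOp_congr_ae _ hFF', kerOp_congr_ae K₂ hFF']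
  have hF' : Measurable F' := hF'm.measurable
  ext ξ
  -- the integrand of the double integral
  set f : V → V → ℂ := fun ζ η => K₁ ξ ζ * (K₂ ζ η * F' η) with hf
  have hfm : AEStronglyMeasurable (uncurry f) (volume.prod volume) := by
    refine (Measurable.stronglyMeasurable ?_).aestronglyMeasurable
    exact ((h₁.measurable_right ξ).comp measurable_fst).mul
      (h₂.measurable.mul (hF'.comp measurable_snd))
  -- integrability on the product
  have hint : Integrable (uncurry f) (volume.prod volume) := by
    rw [integrable_prod_iff hfm]
    constructor
    · exact Eventually.of_forall fun ζ =>
        (h₂.integrable_mul hF'm.aestronglyMeasurable hF't ζ).const_mul (K₁ ξ ζ)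
    · -- `ζ ↦ ∫ ‖f ζ η‖ dη = ‖K₁ ξ ζ‖ ∫ ‖K₂ ζ η F' η‖ dη ≤ ‖K₁ ξ ζ‖ · rowConst ⟨ζ⟩^{m₂-t} W`
      have hrow : ∀ ζ, ∫ η, ‖uncurry f (ζ, η)‖ =
          ‖K₁ ξ ζ‖ * ∫ η, ‖K₂ ζ η * F' η‖ := fun ζ => by
        simp only [uncurry, hf, norm_mul]
        exact integral_const_mul _ _
      have hmeas : AEStronglyMeasurable (fun ζ => ∫ η, ‖uncurry f (ζ, η)‖) volume :=
        hfm.norm.integral_prod_right'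
      refine Integrable.mono' (g := fun ζ => ‖K₁ ξ ζ‖ *
          (rowConst V (m₂ - t) C₂ * bw (m₂ - t) ζ * (wnorm t F').toReal)) ?_ hmeas
        (Eventually.of_forall fun ζ => ?_)
      · have hW : 0 ≤ (wnorm t F').toReal := ENNReal.toReal_nonneg
        have hR := rowConst_nonneg (V := V) h₂.nonneg (m₂ - t)
        exact h₁.integrable_norm_mul_of_norm_le
          (g := fun ζ => rowConst V (m₂ - t) C₂ * bw (m₂ - t) ζ * (wnorm t F').toReal)
          (Continuous.aestronglyMeasurable (by fun_prop)) (mul_nonneg hR hW) (r := m₂ - t)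
          (fun ζ => le_of_eq (by
            rw [Real.norm_of_nonneg (mul_nonneg (mul_nonneg hR (bw_nonneg _ _)) hW)]; ring)) ξ
      · rw [hrow, Real.norm_of_nonneg (mul_nonneg (norm_nonneg _)
          (integral_nonneg fun _ => norm_nonneg _))]
        refine mul_le_mul_of_nonneg_left ?_ (norm_nonneg _)
        rw [integral_norm_eq_lintegral_enorm (f := fun η => K₂ ζ η * F' η)
          ((h₂.measurable_right ζ).aestronglyMeasurable.mul hF'm.aestronglyMeasurable)]
        have hle := (lintegral_congr fun η => enorm_mul (K₂ ζ η) (F' η)).le.trans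
          (h₂.lintegral_row_le t hF'm.aestronglyMeasurable ζ)
        have hnn : 0 ≤ rowConst V (m₂ - t) C₂ * bw (m₂ - t) ζ :=
          mul_nonneg (rowConst_nonneg h₂.nonneg _) (bw_nonneg _ _)
        calc (∫⁻ η, ‖K₂ ζ η * F' η‖ₑ).toReal
            ≤ (ENNReal.ofReal (rowConst V (m₂ - t) C₂ * bw (m₂ - t) ζ) * wnorm t F').toReal :=
              ENNReal.toReal_mono (ENNReal.mul_ne_top ENNReal.ofReal_ne_top hF't.ne) hle
          _ = rowConst V (m₂ - t) C₂ * bw (m₂ - t) ζ * (wnorm t F').toReal := by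
              rw [ENNReal.toReal_mul, ENNReal.toReal_ofReal hnn]
  -- Fubini
  have hswap := integral_integral_swap hint
  simp only [hf] at hswap
  -- left side: `kerOp (kerComp K₁ K₂) F' ξ`
  calc kerOp (kerComp K₁ K₂) F' ξ = ∫ η, ∫ ζ, K₁ ξ ζ * (K₂ ζ η * F' η) := by
        simp only [kerOp, kerComp]
        refine integral_congr_ae (Eventually.of_forall fun η => ?_)
        simp only
        rw [← integral_mul_const]
        exact integral_congr_ae (Eventually.of_forall fun ζ => by ring)
    _ = ∫ ζ, ∫ η, K₁ ξ ζ * (K₂ ζ η * F' η) := hswap.symm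
    _ = kerOp K₁ (kerOp K₂ F') ξ := by
        simp only [kerOp]
        exact integral_congr_ae (Eventually.of_forall fun ζ => integral_const_mul _ _)

/-! ### The second commutator gain -/

section Second

/-- The double-commutator kernel of `[conv θ, [φ, conv θ']]`:
`∫ θ(ξ-ζ) θ'(ζ-η) (φ ζ - φ η - φ ξ + φ (ξ+η-ζ)) dζ`. [folklore] -/
def dcommKer (θ θ' : V → ℂ) (φ : V → ℂ) (ξ η : V) : ℂ :=
  ∫ ζ, θ (ξ - ζ) * θ' (ζ - η) * (φ ζ - φ η - φ ξ + φ (ξ + η - ζ))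

/-- The certificate of `commConvKer`: order `m₁` for differences of order `m₁`. [folklore] -/
theorem MulDiff.kerDecay_commConvKer {φ θ' : V → ℂ} {m₁ d M : ℝ} (hφ : MulDiff φ m₁ d M)
    {D' : ℕ → ℝ} (hθ' : RapidDecay θ' D') :
    KerDecay (commConvKer φ θ') m₁ (fun N => d * D' (N + ⌈M⌉₊)) := by
  have h := hθ'.kerDecay_convKer.comm_mul hφ
  rw [add_zero] at h
  exact h

/-- A polynomially bounded measurable `φ` with differences of order `m₁`: the bound we use
for measurability bookkeeping. The second-difference integrand is measurable. [folklore] -/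
theorem measurable_dcomm_integrand {θ θ' φ : V → ℂ} (hθ : Measurable θ) (hθ' : Measurable θ')
    (hφ : Measurable φ) :
    Measurable fun p : (V × V) × V =>
      θ (p.1.1 - p.2) * θ' (p.2 - p.1.2) *
        (φ p.2 - φ p.1.2 - φ p.1.1 + φ (p.1.1 + p.1.2 - p.2)) := by
  fun_prop

/-- **The kernel identity of the double commutator**: with `T = commConvKer φ θ'`,
`kerComp (convKer θ) T ξ η - kerComp T (convKer θ) ξ η = dcommKer θ θ' φ ξ η`
(change of variables `ζ ↦ ξ + η - ζ` in the second integral). [folklore] -/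
theorem kerComp_convKer_commConvKer_sub {θ θ' φ : V → ℂ} {D D' : ℕ → ℝ} {m₁ d M : ℝ}
    (hθ : RapidDecay θ D) (hθ' : RapidDecay θ' D') (hφ : MulDiff φ m₁ d M) (ξ η : V) :
    kerComp (convKer θ) (commConvKer φ θ') ξ η - kerComp (commConvKer φ θ') (convKer θ) ξ η =
      dcommKer θ θ' φ ξ η := by
  have hT := hφ.kerDecay_commConvKer hθ'
  have hΘ := hθ.kerDecay_convKer
  have hi₁ : Integrable (fun ζ => θ (ξ - ζ) * ((φ ζ - φ η) * θ' (ζ - η))) volume :=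
    hΘ.integrable_comp hT ξ η
  set g : V → ℂ := fun ζ => (φ ξ - φ ζ) * θ' (ξ - ζ) * θ (ζ - η) with hg
  have hi₂ : Integrable g volume := hT.integrable_comp hΘ ξ η
  have h2 : (fun ζ => (φ ξ - φ (ξ + η - ζ)) * θ' (ζ - η) * θ (ξ - ζ)) =
      fun ζ => g (ξ + η - ζ) := by
    ext ζ
    simp only [hg]
    have e1 : ξ - (ξ + η - ζ) = ζ - η := by abel
    have e2 : ξ + η - ζ - η = ξ - ζ := by abel
    rw [e1, e2]
  have hi₂' : Integrable (fun ζ => (φ ξ - φ (ξ + η - ζ)) * θ' (ζ - η) * θ (ξ - ζ)) volume := by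
    rw [h2]; exact hi₂.comp_sub_left (ξ + η)
  have hcv : kerComp (commConvKer φ θ') (convKer θ) ξ η =
      ∫ ζ, (φ ξ - φ (ξ + η - ζ)) * θ' (ζ - η) * θ (ξ - ζ) := by
    calc kerComp (commConvKer φ θ') (convKer θ) ξ η = ∫ ζ, g ζ := rfl
      _ = ∫ ζ, g (ξ + η - ζ) := (integral_sub_left_eq_self g volume (ξ + η)).symm
      _ = _ := by rw [h2]
  rw [hcv]
  change (∫ ζ, θ (ξ - ζ) * ((φ ζ - φ η) * θ' (ζ - η))) - _ = _
  rw [← integral_sub hi₁ hi₂', dcommKer]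
  refine integral_congr_ae (Eventually.of_forall fun ζ => ?_)
  ring

omit [FiniteDimensional ℝ V] [BorelSpace V] in
/-- The pointwise bound of the double-commutator integrand. [folklore] -/
theorem norm_dcomm_integrand_le {θ θ' φ : V → ℂ} {D D' : ℕ → ℝ} {m₂ d M : ℝ}
    (hθ : RapidDecay θ D) (hθ' : RapidDecay θ' D') (hφ : MulDiff2 φ m₂ d M) (N : ℕ)
    (ξ ζ η : V) :
    ‖θ (ξ - ζ) * θ' (ζ - η) * (φ ζ - φ η - φ ξ + φ (ξ + η - ζ))‖ ≤
      d * D (N + ⌈M⌉₊) * D' (N + absorbIndex V 0 + ⌈M⌉₊) * 2 ^ ((N : ℝ) / 2) *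
        bw (-N) (ξ - η) * bw m₂ η * bw (-(Module.finrank ℝ V + 1 : ℝ)) (ζ - η) := by
  set N₁ : ℕ := N + ⌈M⌉₊ with hN₁
  set N₂ : ℕ := N + absorbIndex V 0 + ⌈M⌉₊ with hN₂
  rw [norm_mul, norm_mul]
  -- the second difference, with `u = ζ - η`, `v = ξ - ζ`
  have hΔ : ‖φ ζ - φ η - φ ξ + φ (ξ + η - ζ)‖ ≤ d * bw M (ζ - η) * bw M (ξ - ζ) * bw m₂ η := by
    have h := hφ.bound η (ζ - η) (ξ - ζ)
    have e1 : η + (ζ - η) + (ξ - ζ) = ξ := by abel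
    have e2 : η + (ζ - η) = ζ := by abel
    have e3 : η + (ξ - ζ) = ξ + η - ζ := by abel
    rw [e1, e2, e3] at h
    calc ‖φ ζ - φ η - φ ξ + φ (ξ + η - ζ)‖
        = ‖φ ξ - φ ζ - φ (ξ + η - ζ) + φ η‖ := by
          rw [← norm_neg]; congr 1; ring
      _ ≤ _ := h
  have h1 := hθ.bound N₁ (ξ - ζ)
  have h2 := hθ'.bound N₂ (ζ - η)
  have hA1 := bw_mul_bw_neg_add_ceil_le M N (ξ - ζ)
  have hA2 : bw M (ζ - η) * bw (-(N₂ : ℕ)) (ζ - η) ≤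
      bw (-N) (ζ - η) * bw (-(Module.finrank ℝ V + 1 : ℝ)) (ζ - η) := by
    have h := bw_mul_bw_neg_add_ceil_le M (N + absorbIndex V 0) (ζ - η)
    rw [← hN₂] at h
    refine h.trans ?_
    have h0 := bw_abs_mul_bw_neg_absorbIndex_le 0 (ζ - η)
    rw [abs_zero, bw_zero, one_mul] at h0
    rw [show (-(N + absorbIndex V 0 : ℕ) : ℝ) = -N + -(absorbIndex V 0 : ℕ) by push_cast; ring,
      bw_add]
    exact mul_le_mul_of_nonneg_left h0 (bw_nonneg _ _)
  have hQ := bw_neg_mul_bw_neg_le (Nat.cast_nonneg N) ξ ζ η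
  have cnn : 0 ≤ d * D N₁ * D' N₂ := mul_nonneg (mul_nonneg hφ.nonneg (hθ.nonneg _)) (hθ'.nonneg _)
  calc ‖θ (ξ - ζ)‖ * ‖θ' (ζ - η)‖ * ‖φ ζ - φ η - φ ξ + φ (ξ + η - ζ)‖
      ≤ (D N₁ * bw (-(N₁ : ℕ)) (ξ - ζ)) * (D' N₂ * bw (-(N₂ : ℕ)) (ζ - η)) *
          (d * bw M (ζ - η) * bw M (ξ - ζ) * bw m₂ η) :=
        mul_le_mul (mul_le_mul h1 h2 (norm_nonneg _) (mul_nonneg (hθ.nonneg _) (bw_nonneg _ _)))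
          hΔ (norm_nonneg _) (mul_nonneg (mul_nonneg (hθ.nonneg _) (bw_nonneg _ _))
            (mul_nonneg (hθ'.nonneg _) (bw_nonneg _ _)))
    _ = d * D N₁ * D' N₂ * (bw M (ξ - ζ) * bw (-(N₁ : ℕ)) (ξ - ζ)) *
          (bw M (ζ - η) * bw (-(N₂ : ℕ)) (ζ - η)) * bw m₂ η := by ring
    _ ≤ d * D N₁ * D' N₂ * bw (-N) (ξ - ζ) *
          (bw (-N) (ζ - η) * bw (-(Module.finrank ℝ V + 1 : ℝ)) (ζ - η)) * bw m₂ η := by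
        refine mul_le_mul_of_nonneg_right ?_ (bw_nonneg _ _)
        exact mul_le_mul (mul_le_mul_of_nonneg_left hA1 cnn) hA2
          (mul_nonneg (bw_nonneg _ _) (bw_nonneg _ _)) (mul_nonneg cnn (bw_nonneg _ _))
    _ = d * D N₁ * D' N₂ * (bw (-N) (ξ - ζ) * bw (-N) (ζ - η)) *
          bw (-(Module.finrank ℝ V + 1 : ℝ)) (ζ - η) * bw m₂ η := by ring
    _ ≤ d * D N₁ * D' N₂ * (2 ^ ((N : ℝ) / 2) * bw (-N) (ξ - η)) *
          bw (-(Module.finrank ℝ V + 1 : ℝ)) (ζ - η) * bw m₂ η :=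
        mul_le_mul_of_nonneg_right (mul_le_mul_of_nonneg_right
          (mul_le_mul_of_nonneg_left hQ cnn) (bw_nonneg _ _)) (bw_nonneg _ _)
    _ = _ := by ring

/-- The constants of the double commutator `[conv θ, [φ, conv θ']]` (`φ` with second
differences of constants `d, M`; `θ, θ'` rapidly decreasing with constants `D, D'`).
[folklore] -/
def dcommConst (V : Type*) [NormedAddCommGroup V] [InnerProductSpace ℝ V]
    [FiniteDimensional ℝ V] [MeasurableSpace V] [BorelSpace V]
    (d M : ℝ) (D D' : ℕ → ℝ) (N : ℕ) : ℝ :=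
  d * D (N + ⌈M⌉₊) * D' (N + absorbIndex V 0 + ⌈M⌉₊) * 2 ^ ((N : ℝ) / 2) * I₁ V

/-- **The second commutator gain**: the double-commutator kernel `dcommKer θ θ' φ` is of
order `m₂` when the second differences of `φ` are of order `m₂` (for `φ = ⟨ξ⟩^a`:
`m₂ = a - 2`). [folklore] -/
theorem MulDiff2.kerDecay_dcommKer {θ θ' φ : V → ℂ} {D D' : ℕ → ℝ} {m₂ d M : ℝ}
    (hθ : RapidDecay θ D) (hθ' : RapidDecay θ' D') (hφ : MulDiff2 φ m₂ d M) :
    KerDecay (dcommKer θ θ' φ) m₂ (dcommConst V d M D D') where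
  measurable := by
    have hsm := (measurable_dcomm_integrand hθ.measurable hθ'.measurable
      hφ.measurable).stronglyMeasurable
    exact (hsm.integral_prod_right' (ν := volume)).measurable
  nonneg N := mul_nonneg (mul_nonneg (mul_nonneg (mul_nonneg hφ.nonneg (hθ.nonneg _))
    (hθ'.nonneg _)) (by positivity)) I₁_nonneg
  bound N ξ η := by
    set c : ℝ := d * D (N + ⌈M⌉₊) * D' (N + absorbIndex V 0 + ⌈M⌉₊) * 2 ^ ((N : ℝ) / 2) *
      bw (-N) (ξ - η) * bw m₂ η with hc
    have hg : Integrable (fun ζ => c * bw (-(Module.finrank ℝ V + 1 : ℝ)) (ζ - η)) volume :=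
      (integrable_bw_neg_finrank_add_one.comp_sub_right η).const_mul c
    calc ‖dcommKer θ θ' φ ξ η‖ ≤ ∫ ζ, c * bw (-(Module.finrank ℝ V + 1 : ℝ)) (ζ - η) :=
          norm_integral_le_of_norm_le hg (Eventually.of_forall fun ζ => by
            rw [hc]; exact norm_dcomm_integrand_le hθ hθ' hφ N ξ ζ η)
      _ = c * I₁ V := by
          rw [integral_const_mul, I₁]
          congr 1
          exact integral_sub_right_eq_self (fun ζ => bw (-(Module.finrank ℝ V + 1 : ℝ)) ζ) η
      _ = dcommConst V d M D D' N * bw (-N) (ξ - η) * bw m₂ η := by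
          rw [hc, dcommConst]; ring

/-- **The double commutator as an operator identity**: for `F` of finite weighted norm,
`conv θ (T F) - T (conv θ F) = kerOp (dcommKer θ θ' φ) F`, `T = kerOp (commConvKer φ θ')`,
`conv θ = kerOp (convKer θ)`. [folklore] -/
theorem kerOp_dcomm {θ θ' φ : V → ℂ} {D D' : ℕ → ℝ} {m₁ d M : ℝ}
    (hθ : RapidDecay θ D) (hθ' : RapidDecay θ' D') (hφ : MulDiff φ m₁ d M)
    {t : ℝ} {F : V → ℂ} (hF : InH t F) :
    (fun ξ => kerOp (convKer θ) (kerOp (commConvKer φ θ') F) ξ -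
        kerOp (commConvKer φ θ') (kerOp (convKer θ) F) ξ) =
      kerOp (dcommKer θ θ' φ) F := by
  have hT := hφ.kerDecay_commConvKer hθ'
  have hΘ := hθ.kerDecay_convKer
  rw [← hΘ.kerOp_kerComp hT hF, ← hT.kerOp_kerComp hΘ hF,
    ← (hΘ.comp hT).kerOp_sub_ker (hT.comp hΘ) hF]
  congr 1
  ext ξ η
  exact kerComp_convKer_commConvKer_sub hθ hθ' hφ ξ η

end Second

end Literature.Analysis.Hypoelliptic
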